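import Summits.AtomisticToContinuum.HydrodynamicLimit.Theses.OneFlightGossipEngine
import Literature.Analysis.FluidPDE.EmpiricalCollisionMeasureMeasurableLabels
import Literature.Analysis.FluidPDE.HardSphereCollisionRecord
import Literature.MathematicalPhysics.KineticTheory.HardSphereEulerProofs
import HarnessLib

/-!
# Measurable versions and pathwise bounds of the clamped collision functionals (stub `stub_clampedFunctionalsMeasurable`)

Crux `Summit.AtomisticToContinuum.HydrodynamicLimit.Theses.OneFlightGossipEngine.ClampedCurrentsDock`
(stmt-AtomisticToContinuum-14680), line `IdeatorTwoSketch`, registered stub MZ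
`stub_clampedFunctionalsMeasurable : ClampedFunctionalsMeasurable` (the def re-declared verbatim from the line skeleton).
Yau's entropy inequality is fed, window by window, the CLAMPED collisional row functionals of the ledger: with the
transfer activity `act_i z = (σ/τ) Σ_{collisions c in (0, w], c.fst = i} (‖Δv‖ + |Δ‖v‖²|/2)`, the clamp
`ω_i = 𝟙{act_i ≤ V}` and the rows `Xm φ k = Σ_c ω_fst ω_snd (φ(x_fst) − φ(x_snd)) (Δv)_k / 2`,
`Xe φ = Σ_c ω_fst ω_snd (φ(x_fst) − φ(x_snd)) (Δ‖v‖²/2) / 2`: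
(1) each agrees on the good set with a MEASURABLE function of the datum — a summand seeing the labels, the two positions
and the pre- and post-collisional velocities of the first partner is, on the records of contact pairs, a continuous
function of the labels and of the collision MARK `(t, x_fst, ω, v⁻, w⁻)` (`x_snd = x_fst − proj (ε ω)`,
`v⁺ = v⁻ − ⟪v⁻ − w⁻, ω⟫ ω`: the elastic reflection is a scale-invariant involution and `‖ω‖ = 1` at contact), so the
label-aware engine `HardSphereFlow.measurable_indicator_of_eqOn_collisionSum_labels` applies, the `z`-dependent clamp
weights coming out of the finite collision sum split along the fibres of `(c.fst, c.snd)`; (2) the activities are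
nonnegative; (3) on the good set `|Xm|, |Xe| ≤ L w (N+1) V₊`: at contact `|φ(x_fst) − φ(x_snd)| ≤ L ε_N`,
`|(Δv)_k|, |Δ‖v‖²|/2 ≤ ‖Δv‖ + |Δ‖v‖²|/2`, `ω_i Σ_{c.fst = i}(…) ≤ (τ/σ) V₊` and `ε_N τ/σ = w`.
References: H.-T. Yau, Lett. Math. Phys. 22 (1991) §2 (the clamp of the collisional currents); I. Gallagher,
L. Saint-Raymond, B. Texier, *From Newton to Boltzmann* (2013), §4.1 (collision records of the hard-sphere flow).
-/

noncomputable section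

namespace Summit.AtomisticToContinuum.HydrodynamicLimit.Theorems.ClampedCurrentsDockClampedMeasurable

open scoped BigOperators ENNReal Classical Interval
open MeasureTheory Filter Set Topology InformationTheory
open Literature.MathematicalPhysics.KineticTheory Literature.Analysis.FluidPDE Literature.Analysis.FunctionSpaces
open Summit.AtomisticToContinuum.HydrodynamicLimit.Theses.OneFlightGossipEngine
open Summit.AtomisticToContinuum.HydrodynamicLimit.Theorems
open scoped InnerProductSpace

/-! ## The statement (verbatim from the line skeleton) -/

/-- registered stub signature MZ of line IdeatorTwoSketch, crux ClampedCurrentsDock — route-internal, not a cited fact -/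
def ClampedFunctionalsMeasurable : Prop :=
  ∀ (σ : ℝ) (N : ℕ) (Φ : HardSphereFlow (Torus.geometry (Fin 3)) (hsDiameter σ N) (N + 1))
    (θ₀ : T3 → ℝ) (u₀ : T3 → V3) (V τ L : ℝ), 0 < σ → σ < 1 / 2 → 0 < τ →
    Continuous θ₀ → Continuous u₀ → (∀ x, 0 < θ₀ x) → 0 ≤ L →
    (∀ (k : Fin 3) (x y : T3), |u₀ x k / θ₀ x - u₀ y k / θ₀ y| ≤ L * Torus.euclidDist x y) →
    (∀ x y : T3, |(-(θ₀ x)⁻¹) - (-(θ₀ y)⁻¹)| ≤ L * Torus.euclidDist x y) →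
      (let w : ℝ := τ * ((N : ℝ) + 1) ^ (-(1 / 3 : ℝ))
       let act := fun (i : Fin (N + 1)) (z : Config (N + 1) (Fin 3) T3) =>
         σ / τ * Φ.collisionSum (Set.Ioc 0 w) (fun c => if c.fst = i then
           ‖c.postVel.1 - c.preVel.1‖ + |‖c.postVel.1‖ ^ 2 - ‖c.preVel.1‖ ^ 2| / 2 else 0) z
       let ω := fun (i : Fin (N + 1)) (z : Config (N + 1) (Fin 3) T3) => if act i z ≤ V then (1 : ℝ) else 0
       let Xm := fun (φ : T3 → ℝ) (k : Fin 3) (z : Config (N + 1) (Fin 3) T3) =>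
         Φ.collisionSum (Set.Ioc 0 w)
           (fun c => ω c.fst z * ω c.snd z * ((φ c.fstPos - φ c.sndPos) * (c.postVel.1 k - c.preVel.1 k)) / 2) z
       let Xe := fun (φ : T3 → ℝ) (z : Config (N + 1) (Fin 3) T3) =>
         Φ.collisionSum (Set.Ioc 0 w)
           (fun c => ω c.fst z * ω c.snd z *
             ((φ c.fstPos - φ c.sndPos) * ((‖c.postVel.1‖ ^ 2 - ‖c.preVel.1‖ ^ 2) / 2)) / 2) z
       (∀ i, ∃ A : Config (N + 1) (Fin 3) T3 → ℝ, Measurable A ∧ Set.EqOn A (act i) Φ.good) ∧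
       (∀ z ∈ Φ.good, ∀ i, 0 ≤ act i z) ∧
       (∀ k : Fin 3, ∃ Y : Config (N + 1) (Fin 3) T3 → ℝ, Measurable Y ∧
          Set.EqOn Y (Xm (fun x => u₀ x k / θ₀ x) k) Φ.good) ∧
       (∃ Y : Config (N + 1) (Fin 3) T3 → ℝ, Measurable Y ∧ Set.EqOn Y (Xe (fun x => -(θ₀ x)⁻¹)) Φ.good) ∧
       (∀ z ∈ Φ.good, ∀ k : Fin 3, |Xm (fun x => u₀ x k / θ₀ x) k z| ≤ L * w * ((N : ℝ) + 1) * max V 0) ∧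
       (∀ z ∈ Φ.good, |Xe (fun x => -(θ₀ x)⁻¹) z| ≤ L * w * ((N : ℝ) + 1) * max V 0))


variable {σ : ℝ} {N : ℕ}

/-! ## §1 Records of contact pairs read through the collision mark -/

/-- The post-collisional velocity of the first partner read off the mark `(t, x, ω, v, w)`: `v − ⟪v − w, ω⟫ ω` (the
elastic law at a unit impact vector). [folklore] -/
def markPost (m : ℝ × T3 × V3 × V3 × V3) : V3 :=
  m.2.2.2.1 - ⟪m.2.2.2.1 - m.2.2.2.2, m.2.2.1⟫_ℝ • m.2.2.1

/-- The partner's position read off the mark: `x − proj (ε ω)`. [folklore] -/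
def markSnd (ε : ℝ) (m : ℝ × T3 × V3 × V3 × V3) : T3 :=
  m.2.1 - Torus.proj (ε • m.2.2.1)

/-- `markPost` is continuous (a polynomial map of the mark). [folklore] -/
@[fun_prop]
theorem continuous_markPost : Continuous markPost := by
  unfold markPost
  fun_prop

/-- `markSnd ε` is continuous (the covering map `proj` is). [folklore] -/
@[fun_prop]
theorem continuous_markSnd (ε : ℝ) : Continuous (markSnd ε) :=
  (continuous_fst.comp continuous_snd).sub (Torus.continuous_proj.comp
    ((continuous_fst.comp (continuous_snd.comp continuous_snd)).const_smul ε))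

/-- On the record of an ordered pair read off a configuration, the partner sits at `markSnd ε (mark)`:
`x_snd = x_fst − proj (ε ω)` (`proj ∘ reprSym = id`; no contact needed, only `ε ≠ 0`). [folklore] -/
theorem markSnd_mark_ofConfig {n : ℕ} {ε : ℝ} (hε : ε ≠ 0) (z : Config n (Fin 3) T3) (t : ℝ) (i j : Fin n) :
    markSnd ε (HardSphereCollisionRecord.ofConfig (Torus.geometry (Fin 3)) ε z t i j).mark = (z j).1 := by
  simp only [markSnd, HardSphereCollisionRecord.mark_def, HardSphereCollisionRecord.ofConfig_fstPos,
    HardSphereCollisionRecord.ofConfig_impactVec, smul_smul, mul_inv_cancel₀ hε, one_smul, Torus.geometry_sepVec,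
    Torus.proj_reprSym, sub_sub_cancel]

/-- On the record of a CONTACT pair (`‖ω‖ = 1`) the post-collisional velocity of the first partner is
`markPost (mark)`: the elastic reflection `reflectVel` is a scale-invariant involution. [folklore] -/
theorem markPost_mark_ofConfig {n : ℕ} {ε : ℝ} (hε : 0 < ε) {z : Config n (Fin 3) T3} (t : ℝ) {i j : Fin n}
    (hc : z ∈ contactSet (Torus.geometry (Fin 3)) n ε i j) :
    markPost (HardSphereCollisionRecord.ofConfig (Torus.geometry (Fin 3)) ε z t i j).mark = (z i).2 := by
  have hω := HardSphereCollisionRecord.norm_ofConfig_impactVec hε t hc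
  have key : reflectVel (HardSphereCollisionRecord.ofConfig (Torus.geometry (Fin 3)) ε z t i j).impactVec
      (HardSphereCollisionRecord.ofConfig (Torus.geometry (Fin 3)) ε z t i j).preVel =
      (HardSphereCollisionRecord.ofConfig (Torus.geometry (Fin 3)) ε z t i j).postVel := by
    rw [HardSphereCollisionRecord.ofConfig_impactVec, reflectVel_smul (inv_ne_zero hε.ne'),
      HardSphereCollisionRecord.ofConfig_preVel, reflectVel_reflectVel, HardSphereCollisionRecord.ofConfig_postVel]
  have e : (z i).2 = (reflectVel (HardSphereCollisionRecord.ofConfig (Torus.geometry (Fin 3)) ε z t i j).impactVec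
      (HardSphereCollisionRecord.ofConfig (Torus.geometry (Fin 3)) ε z t i j).preVel).1 := by
    rw [key, HardSphereCollisionRecord.ofConfig_postVel]
  rw [e]
  simp only [markPost, HardSphereCollisionRecord.mark_def, reflectVel, hω, one_pow, div_one]

/-- **Reading a summand through the mark.** A summand of a collision sum along the flow that sees the labels, the two
positions and the pre- and post-collisional velocities of the first partner agrees, on the records of the contact
pairs of the orbit, with the same expression read off the labels and the mark; so the two collision sums coincide
(`collisionSum_congr`; every datum). [folklore] -/
theorem collisionSum_eq_collisionSum_mark {M : Type*} [AddCommMonoid M] (hσ : 0 < σ)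
    (Φ : HardSphereFlow (Torus.geometry (Fin 3)) (hsDiameter σ N) (N + 1))
    (Q : Fin (N + 1) → Fin (N + 1) → T3 → T3 → V3 → V3 → M) (S : Set ℝ) (z : Config (N + 1) (Fin 3) T3) :
    Φ.collisionSum S (fun c => Q c.fst c.snd c.fstPos c.sndPos c.preVel.1 c.postVel.1) z =
      Φ.collisionSum S (fun c => Q c.fst c.snd c.mark.2.1 (markSnd (hsDiameter σ N) c.mark) c.mark.2.2.2.1
        (markPost c.mark)) z := by
  have hε0 : 0 < hsDiameter σ N := hsDiameter_pos hσ N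
  rw [HardSphereFlow.collisionSum_eq, HardSphereFlow.collisionSum_eq]
  refine collisionSum_congr fun t _ p hp => ?_
  obtain ⟨-, hc⟩ := mem_contactPairs.1 hp
  rw [markSnd_mark_ofConfig hε0.ne', markPost_mark_ofConfig hε0 t hc]
  rfl

/-- **Measurability through the mark.** For a family `Q i j` of continuous functions of (two positions, two
velocities), the collision sum over `(a, b]` of `Q c.fst c.snd x_fst x_snd v_fst⁻ v_fst⁺` along the flow, extended by
`0` off the good set, is measurable in the datum (`0 < σ < 1/2`: regular measurable torus geometry; the label-aware
engine `HardSphereFlow.measurable_indicator_of_eqOn_collisionSum_labels` through `collisionSum_eq_collisionSum_mark`).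
[folklore] -/
theorem measurable_indicator_collisionSum_mark (hσ : 0 < σ) (hσ2 : σ < 1 / 2)
    (Φ : HardSphereFlow (Torus.geometry (Fin 3)) (hsDiameter σ N) (N + 1))
    {Q : Fin (N + 1) → Fin (N + 1) → T3 → T3 → V3 → V3 → ℝ}
    (hQ : ∀ i j, Continuous fun q : T3 × T3 × V3 × V3 => Q i j q.1 q.2.1 q.2.2.1 q.2.2.2) (a b : ℝ) :
    Measurable (Φ.good.indicator fun z =>
      Φ.collisionSum (Ioc a b) (fun c => Q c.fst c.snd c.fstPos c.sndPos c.preVel.1 c.postVel.1) z) := by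
  have hε : hsDiameter σ N < 2⁻¹ := (hsDiameter_le hσ.le N).trans_lt (by rw [inv_eq_one_div]; exact hσ2)
  have h4 : Continuous fun m : ℝ × T3 × V3 × V3 × V3 => (m.2.1, markSnd (hsDiameter σ N) m, m.2.2.2.1, markPost m) :=
    by fun_prop
  have hF : ∀ i j, Continuous fun m : ℝ × T3 × V3 × V3 × V3 =>
      Q i j m.2.1 (markSnd (hsDiameter σ N) m) m.2.2.2.1 (markPost m) := fun i j => (hQ i j).comp h4
  exact Φ.measurable_indicator_of_eqOn_collisionSum_labels (Torus.isHardSphereRegular_geometry hε)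
    Torus.isMeasurable_geometry hF (fun i j => (hF i j).measurable) a b
    fun z _ => collisionSum_eq_collisionSum_mark hσ Φ Q _ z

/-! ## §2 Finite-sum algebra: collecting the fibres of the labels -/

/-- Collecting the fibres of one label: `Σ_x η(g x) f x = Σ_i η_i Σ_{g x = i} f x`. [folklore] -/
theorem sum_mul_eq_sum_fiber {ι : Type*} (E : Finset ι) {n : ℕ} (g : ι → Fin n) (η : Fin n → ℝ) (f : ι → ℝ) :
    ∑ x ∈ E, η (g x) * f x = ∑ i, η i * ∑ x ∈ E, (if g x = i then f x else 0) := by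
  have key : ∀ x, η (g x) * f x = ∑ i, η i * (if g x = i then f x else 0) := fun x => by
    rw [Finset.sum_eq_single_of_mem (g x) (Finset.mem_univ _) fun i _ hi => by rw [if_neg (Ne.symm hi), mul_zero],
      if_pos rfl]
  calc ∑ x ∈ E, η (g x) * f x = ∑ x ∈ E, ∑ i, η i * (if g x = i then f x else 0) :=
        Finset.sum_congr rfl fun x _ => key x
    _ = ∑ i, ∑ x ∈ E, η i * (if g x = i then f x else 0) := Finset.sum_comm
    _ = ∑ i, η i * ∑ x ∈ E, (if g x = i then f x else 0) :=
        Finset.sum_congr rfl fun i _ => by rw [Finset.mul_sum]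

/-- Collecting the fibres of two labels: `Σ_x η(g x) η(h x) f x / 2 = Σ_i Σ_j η_i η_j Σ_{g x = i, h x = j} f x / 2`.
[folklore] -/
theorem sum_mul_mul_eq_sum_fiber₂ {ι : Type*} (E : Finset ι) {n : ℕ} (g h : ι → Fin n) (η : Fin n → ℝ)
    (f : ι → ℝ) :
    ∑ x ∈ E, η (g x) * η (h x) * f x / 2 =
      ∑ i, ∑ j, η i * η j * ∑ x ∈ E, (if g x = i then (if h x = j then f x / 2 else 0) else 0) := by
  have key : ∀ x, η (g x) * η (h x) * f x / 2 =
      ∑ i, ∑ j, η i * η j * (if g x = i then (if h x = j then f x / 2 else 0) else 0) := fun x => by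
    rw [Finset.sum_eq_single_of_mem (g x) (Finset.mem_univ _)]
    · rw [Finset.sum_eq_single_of_mem (h x) (Finset.mem_univ _)]
      · rw [if_pos rfl, if_pos rfl, mul_div_assoc]
      · intro j _ hj
        rw [if_pos rfl, if_neg (Ne.symm hj), mul_zero]
    · intro i _ hi
      exact Finset.sum_eq_zero fun j _ => by rw [if_neg (Ne.symm hi), mul_zero]
  calc ∑ x ∈ E, η (g x) * η (h x) * f x / 2
      = ∑ x ∈ E, ∑ i, ∑ j, η i * η j * (if g x = i then (if h x = j then f x / 2 else 0) else 0) :=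
        Finset.sum_congr rfl fun x _ => key x
    _ = ∑ i, ∑ x ∈ E, ∑ j, η i * η j * (if g x = i then (if h x = j then f x / 2 else 0) else 0) :=
        Finset.sum_comm
    _ = ∑ i, ∑ j, ∑ x ∈ E, η i * η j * (if g x = i then (if h x = j then f x / 2 else 0) else 0) :=
        Finset.sum_congr rfl fun i _ => Finset.sum_comm
    _ = _ := Finset.sum_congr rfl fun i _ => Finset.sum_congr rfl fun j _ => by rw [Finset.mul_sum]

/-- **A clamped finite sum is small.** If `η ∈ {0, 1}`, `|a x| ≤ K D x` with `D ≥ 0` on `E`, and every clamped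
fibre sum `η_i Σ_{g x = i} D x` is at most `B`, then `|Σ_x η(g x) η(h x) a x / 2| ≤ K n B / 2`. [folklore] -/
theorem abs_sum_clamped_le {ι : Type*} (E : Finset ι) {n : ℕ} (g h : ι → Fin n) {η : Fin n → ℝ}
    (hη : ∀ i, η i = 0 ∨ η i = 1) {K : ℝ} (hK : 0 ≤ K) (a D : ι → ℝ) (hD : ∀ x ∈ E, 0 ≤ D x)
    (ha : ∀ x ∈ E, |a x| ≤ K * D x) {B : ℝ} (hB : ∀ i, η i * ∑ x ∈ E, (if g x = i then D x else 0) ≤ B) :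
    |∑ x ∈ E, η (g x) * η (h x) * a x / 2| ≤ K * (n : ℝ) * B / 2 := by
  have hterm : ∀ x ∈ E, |η (g x) * η (h x) * a x / 2| ≤ η (g x) * (K * D x) / 2 := by
    intro x hx
    rcases hη (g x) with h0 | h1
    · rw [h0]
      simp
    rw [h1, one_mul, one_mul]
    rcases hη (h x) with h0' | h1'
    · rw [h0', zero_mul, zero_div, abs_zero]
      exact div_nonneg (mul_nonneg hK (hD x hx)) zero_le_two
    · rw [h1', one_mul, abs_div, abs_two]
      exact div_le_div_of_nonneg_right (ha x hx) zero_le_two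
  calc |∑ x ∈ E, η (g x) * η (h x) * a x / 2| ≤ ∑ x ∈ E, |η (g x) * η (h x) * a x / 2| :=
        Finset.abs_sum_le_sum_abs _ _
    _ ≤ ∑ x ∈ E, η (g x) * (K * D x) / 2 := Finset.sum_le_sum hterm
    _ = K / 2 * ∑ x ∈ E, η (g x) * D x := by
        rw [Finset.mul_sum]
        exact Finset.sum_congr rfl fun x _ => by ring
    _ = K / 2 * ∑ i, η i * ∑ x ∈ E, (if g x = i then D x else 0) := by rw [sum_mul_eq_sum_fiber]
    _ ≤ K / 2 * ∑ _i : Fin n, B := by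
        gcongr with i
        exact hB i
    _ = K * (n : ℝ) * B / 2 := by
        rw [Finset.sum_const, Finset.card_univ, Fintype.card_fin, nsmul_eq_mul]
        ring

/-! ## §3 Collision sums along the flow on the good set -/

/-- On the good set a collision sum over a bounded window is a finite sum over the collision events
`(t, (fst, snd))` (finitely many collision times, `HardSphereFlow.finite_collisionTimes_inter`). [folklore] -/
theorem collisionSum_eq_sum_sigma {M : Type*} [AddCommMonoid M]
    (Φ : HardSphereFlow (Torus.geometry (Fin 3)) (hsDiameter σ N) (N + 1)) {z : Config (N + 1) (Fin 3) T3}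
    (hz : z ∈ Φ.good) {S : Set ℝ} {a b : ℝ} (hS : S ⊆ Icc a b)
    (F : HardSphereCollisionRecord (Fin 3) T3 (N + 1) → M) :
    Φ.collisionSum S F z = ∑ x ∈ (Φ.finite_collisionTimes_inter hz hS).toFinset.sigma
        (fun t => contactPairs (Torus.geometry (Fin 3)) (hsDiameter σ N) (Φ.flow t z)),
      F (HardSphereCollisionRecord.ofConfig (Torus.geometry (Fin 3)) (hsDiameter σ N) (Φ.flow x.1 z) x.1 x.2.1
        x.2.2) := by
  rw [HardSphereFlow.collisionSum_eq, collisionSum_eq_finset_sum (Φ.finite_collisionTimes_inter hz hS),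
    Finset.sum_sigma]

/-- **The clamp weights come out of the collision sum.** On the good set, for weights `η` on the labels,
`Σ_c η(c.fst) η(c.snd) R c / 2 = Σ_i Σ_j η_i η_j Σ_c 𝟙{c.fst = i} 𝟙{c.snd = j} R c / 2`. [folklore] -/
theorem collisionSum_clamped_eq_sum (Φ : HardSphereFlow (Torus.geometry (Fin 3)) (hsDiameter σ N) (N + 1))
    {z : Config (N + 1) (Fin 3) T3} (hz : z ∈ Φ.good) (η : Fin (N + 1) → ℝ)
    (R : HardSphereCollisionRecord (Fin 3) T3 (N + 1) → ℝ) (w : ℝ) :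
    Φ.collisionSum (Ioc 0 w) (fun c => η c.fst * η c.snd * R c / 2) z =
      ∑ i, ∑ j, η i * η j *
        Φ.collisionSum (Ioc 0 w) (fun c => if c.fst = i then (if c.snd = j then R c / 2 else 0) else 0) z := by
  simp only [collisionSum_eq_sum_sigma Φ hz (Ioc_subset_Icc_self (a := (0 : ℝ)) (b := w)),
    HardSphereCollisionRecord.ofConfig_fst, HardSphereCollisionRecord.ofConfig_snd]
  exact sum_mul_mul_eq_sum_fiber₂ _ (fun x : (_ : ℝ) × (Fin (N + 1) × Fin (N + 1)) => x.2.1) (fun x => x.2.2) η _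

/-- **The clamped row functionals are small on the good set.** With `η ∈ {0, 1}`, `φ` `L`-Lipschitz for the
minimal-image distance, `|δ(v⁻, v⁺)| ≤ ‖v⁺ − v⁻‖ + |‖v⁺‖² − ‖v⁻‖²|/2`, and every clamped transfer sum
`η_i Σ_{c.fst = i} (‖Δv‖ + |Δ‖v‖²|/2)` at most `B`: `|Σ_c η_fst η_snd (φ(x_fst) − φ(x_snd)) δ / 2| ≤ L ε_N (N+1) B / 2`
(at contact `dist(x_fst, x_snd) = ε_N`, `Torus.norm_geometry_sepVec`). [folklore] -/
theorem abs_collisionSum_clamped_le (hσ : 0 < σ)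
    (Φ : HardSphereFlow (Torus.geometry (Fin 3)) (hsDiameter σ N) (N + 1)) {z : Config (N + 1) (Fin 3) T3}
    (hz : z ∈ Φ.good) {L : ℝ} (hL : 0 ≤ L) {φ : T3 → ℝ} (hφ : ∀ x y, |φ x - φ y| ≤ L * Torus.euclidDist x y)
    {δ : V3 → V3 → ℝ} (hδ : ∀ v v', |δ v v'| ≤ ‖v' - v‖ + |‖v'‖ ^ 2 - ‖v‖ ^ 2| / 2) {η : Fin (N + 1) → ℝ}
    (hη : ∀ i, η i = 0 ∨ η i = 1) {w B : ℝ}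
    (hB : ∀ i, η i * Φ.collisionSum (Ioc 0 w) (fun c => if c.fst = i then
      ‖c.postVel.1 - c.preVel.1‖ + |‖c.postVel.1‖ ^ 2 - ‖c.preVel.1‖ ^ 2| / 2 else 0) z ≤ B) :
    |Φ.collisionSum (Ioc 0 w)
        (fun c => η c.fst * η c.snd * ((φ c.fstPos - φ c.sndPos) * δ c.preVel.1 c.postVel.1) / 2) z| ≤
      L * hsDiameter σ N * ((N : ℝ) + 1) * B / 2 := by
  have hε0 : 0 < hsDiameter σ N := hsDiameter_pos hσ N
  simp only [collisionSum_eq_sum_sigma Φ hz (Ioc_subset_Icc_self (a := (0 : ℝ)) (b := w)),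
    HardSphereCollisionRecord.ofConfig_fst, HardSphereCollisionRecord.ofConfig_snd] at hB ⊢
  refine (abs_sum_clamped_le _ (fun x : (_ : ℝ) × (Fin (N + 1) × Fin (N + 1)) => x.2.1) (fun x => x.2.2) hη
    (mul_nonneg hL hε0.le) _ _ (fun x _ => by positivity) (fun x hx => ?_) hB).trans_eq (by push_cast; ring)
  -- at contact the two partners are at minimal-image distance `ε_N` (`Torus.norm_geometry_sepVec`)
  obtain ⟨-, hc⟩ := mem_contactPairs.1 (Finset.mem_sigma.1 hx).2
  rw [abs_mul]
  refine mul_le_mul ((hφ _ _).trans_eq ?_) (hδ _ _) (abs_nonneg _) (mul_nonneg hL hε0.le)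
  rw [← Torus.norm_geometry_sepVec]
  exact congrArg (L * ·) (mem_contactSet.1 hc).2

/-- **Measurable version of a clamped row functional.** For measurable `A_i`, continuous `φ` and `δ`, the function
`z ↦ Σ_i Σ_j 𝟙{A_i z ≤ V} 𝟙{A_j z ≤ V} · 𝟙_good(z) Σ_{c : fst = i, snd = j} (φ(x_fst) − φ(x_snd)) δ(v⁻, v⁺) / 2`
is measurable. [folklore] -/
theorem measurable_clampedRow (hσ : 0 < σ) (hσ2 : σ < 1 / 2)
    (Φ : HardSphereFlow (Torus.geometry (Fin 3)) (hsDiameter σ N) (N + 1)) {φ : T3 → ℝ} (hφ : Continuous φ)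
    {δ : V3 → V3 → ℝ} (hδ : Continuous fun q : V3 × V3 => δ q.1 q.2)
    {A : Fin (N + 1) → Config (N + 1) (Fin 3) T3 → ℝ} (hA : ∀ i, Measurable (A i)) (V a b : ℝ) :
    Measurable fun z => ∑ i, ∑ j, (if A i z ≤ V then (1 : ℝ) else 0) * (if A j z ≤ V then (1 : ℝ) else 0) *
      Φ.good.indicator (fun z => Φ.collisionSum (Ioc a b) (fun c => if c.fst = i then
        (if c.snd = j then (φ c.fstPos - φ c.sndPos) * δ c.preVel.1 c.postVel.1 / 2 else 0) else 0) z) z := by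
  refine Finset.measurable_sum _ fun i _ => Finset.measurable_sum _ fun j _ => ?_
  refine ((Measurable.ite (measurableSet_le (hA i) measurable_const) measurable_const measurable_const).mul
    (Measurable.ite (measurableSet_le (hA j) measurable_const) measurable_const measurable_const)).mul ?_
  have hδ' : Continuous fun q : T3 × T3 × V3 × V3 => δ q.2.2.1 q.2.2.2 := hδ.comp (by fun_prop)
  have hc : Continuous fun q : T3 × T3 × V3 × V3 => (φ q.1 - φ q.2.1) * δ q.2.2.1 q.2.2.2 / 2 :=
    (((hφ.comp continuous_fst).sub (hφ.comp (continuous_fst.comp continuous_snd))).mul hδ').div_const 2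
  refine measurable_indicator_collisionSum_mark hσ hσ2 Φ
    (Q := fun i' j' x y v v' => if i' = i then (if j' = j then (φ x - φ y) * δ v v' / 2 else 0) else 0)
    (fun i' j' => ?_) a b
  by_cases hi : i' = i
  · by_cases hj : j' = j
    · simp only [hi, hj, if_true]
      exact hc
    · simp only [hi, hj, if_true, if_false]
      exact continuous_const
  · simp only [hi, if_false]
    exact continuous_const

/-! ## §4 The stub -/

/-- **MZ — measurable versions and pathwise bounds of the clamped collision functionals** (stub
`stub_clampedFunctionalsMeasurable` of line `IdeatorTwoSketch`, crux `ClampedCurrentsDock`,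
stmt-AtomisticToContinuum-14680):
activities and split rows read through the mark (`measurable_indicator_collisionSum_mark`), clamp weights pulled out
of the finite collision sum (`collisionSum_clamped_eq_sum`), nonnegative transfer kernels, and the bound
`abs_collisionSum_clamped_le` with `B = (τ/σ) V₊`, `ε_N τ/σ = w`. [folklore] -/
theorem stub_clampedFunctionalsMeasurable : ClampedFunctionalsMeasurable := by
  intro σ N Φ θ₀ u₀ V τ L hσ hσ2 hτ hθ hu hθ0 hL hLm hLe w act ω Xm Xe
  have hε0 : 0 < hsDiameter σ N := hsDiameter_pos hσ N
  have hκ : 0 < σ / τ := div_pos hσ hτ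
  have hw0 : 0 < w := mul_pos hτ (Real.rpow_pos_of_pos (by positivity) _)
  have hεw : hsDiameter σ N * (τ / σ) = w := by
    simp only [w, hsDiameter]
    push_cast
    field_simp
  have hθne : ∀ x, θ₀ x ≠ 0 := fun x => (hθ0 x).ne'
  -- the transfer kernel is nonnegative, hence so are the activities (every datum)
  have hC0 : ∀ (i : Fin (N + 1)) (z : Config (N + 1) (Fin 3) T3), 0 ≤ Φ.collisionSum (Ioc 0 w) (fun c =>
      if c.fst = i then ‖c.postVel.1 - c.preVel.1‖ + |‖c.postVel.1‖ ^ 2 - ‖c.preVel.1‖ ^ 2| / 2 else 0) z := by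
    intro i z
    rw [HardSphereFlow.collisionSum_eq, collisionSum_eq_collisionPairSum]
    exact collisionPairSum_nonneg fun _ _ _ => by split_ifs <;> positivity
  have hact0 : ∀ i z, 0 ≤ act i z := fun i z => mul_nonneg hκ.le (hC0 i z)
  -- the activities read through the mark
  have hCm : ∀ i : Fin (N + 1), Measurable (Φ.good.indicator fun z => Φ.collisionSum (Ioc 0 w) (fun c =>
      if c.fst = i then ‖c.postVel.1 - c.preVel.1‖ + |‖c.postVel.1‖ ^ 2 - ‖c.preVel.1‖ ^ 2| / 2 else 0) z) := by
    intro i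
    refine measurable_indicator_collisionSum_mark hσ hσ2 Φ
      (Q := fun i' _ _ _ v v' => if i' = i then ‖v' - v‖ + |‖v'‖ ^ 2 - ‖v‖ ^ 2| / 2 else 0) (fun i' j' => ?_) 0 w
    by_cases hi : i' = i
    · simp only [hi, if_true]
      fun_prop
    · simp only [hi, if_false]
      exact continuous_const
  -- the measurable versions `A i` of the activities
  set A : Fin (N + 1) → Config (N + 1) (Fin 3) T3 → ℝ := fun i z => σ / τ * Φ.good.indicator (fun z =>
    Φ.collisionSum (Ioc 0 w) (fun c => if c.fst = i then
      ‖c.postVel.1 - c.preVel.1‖ + |‖c.postVel.1‖ ^ 2 - ‖c.preVel.1‖ ^ 2| / 2 else 0) z) z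
  have hAm : ∀ i, Measurable (A i) := fun i => (hCm i).const_mul _
  have hAeq : ∀ i, EqOn (A i) (act i) Φ.good := fun i z hz => by
    simp only [A, indicator_of_mem hz]
    rfl
  -- the clamp weights at a good datum
  have hω01 : ∀ i z, ω i z = 0 ∨ ω i z = 1 := fun i z => by
    by_cases h : act i z ≤ V
    · exact Or.inr (if_pos h)
    · exact Or.inl (if_neg h)
  have hωB : ∀ z i, ω i z * Φ.collisionSum (Ioc 0 w) (fun c => if c.fst = i then
      ‖c.postVel.1 - c.preVel.1‖ + |‖c.postVel.1‖ ^ 2 - ‖c.preVel.1‖ ^ 2| / 2 else 0) z ≤ τ / σ * max V 0 := by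
    intro z i
    by_cases h : act i z ≤ V
    · rw [show ω i z = 1 from if_pos h, one_mul]
      have key : ∀ C : ℝ, C = τ / σ * (σ / τ * C) := fun C => by field_simp
      calc _ = τ / σ * act i z := key _
        _ ≤ τ / σ * max V 0 := mul_le_mul_of_nonneg_left (h.trans (le_max_left _ _)) (by positivity)
    · rw [show ω i z = 0 from if_neg h, zero_mul]
      positivity
  have hωA : ∀ z ∈ Φ.good, ∀ i, (if A i z ≤ V then (1 : ℝ) else 0) = ω i z := fun z hz i => by
    rw [hAeq i hz]
  -- the final constant
  have hfin : L * hsDiameter σ N * ((N : ℝ) + 1) * (τ / σ * max V 0) / 2 ≤ L * w * ((N : ℝ) + 1) * max V 0 := by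
    rw [show L * hsDiameter σ N * ((N : ℝ) + 1) * (τ / σ * max V 0) / 2 =
      L * w * ((N : ℝ) + 1) * max V 0 / 2 by rw [← hεw]; ring]
    exact half_le_self (mul_nonneg (mul_nonneg (mul_nonneg hL hw0.le) (by positivity)) (le_max_right _ _))
  -- Lipschitz moduli of `δ`
  have hδm : ∀ (k : Fin 3) (v v' : V3), |v' k - v k| ≤ ‖v' - v‖ + |‖v'‖ ^ 2 - ‖v‖ ^ 2| / 2 := fun k v v' =>
    calc |v' k - v k| = ‖(v' - v) k‖ := by rw [PiLp.sub_apply, Real.norm_eq_abs]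
      _ ≤ ‖v' - v‖ := PiLp.norm_apply_le _ _
      _ ≤ _ := le_add_of_nonneg_right (by positivity)
  have hδe : ∀ v v' : V3, |(‖v'‖ ^ 2 - ‖v‖ ^ 2) / 2| ≤ ‖v' - v‖ + |‖v'‖ ^ 2 - ‖v‖ ^ 2| / 2 := fun v v' => by
    rw [abs_div, abs_two]
    exact le_add_of_nonneg_left (norm_nonneg _)
  have hφm : ∀ k : Fin 3, Continuous fun x => u₀ x k / θ₀ x := fun k => by fun_prop (disch := exact hθne _)
  have hφe : Continuous fun x => -(θ₀ x)⁻¹ := by fun_prop (disch := exact hθne _)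
  refine ⟨fun i => ⟨A i, hAm i, hAeq i⟩, fun z _ i => hact0 i z, fun k => ?_, ?_, fun z hz k => ?_, fun z hz => ?_⟩
  · refine ⟨_, measurable_clampedRow hσ hσ2 Φ (hφm k) (δ := fun v v' => v' k - v k) (by fun_prop) hAm V 0 w,
      fun z hz => ?_⟩
    simp only [hωA z hz, indicator_of_mem hz]
    exact (collisionSum_clamped_eq_sum Φ hz (fun i => ω i z) _ w).symm
  · refine ⟨_, measurable_clampedRow hσ hσ2 Φ hφe (δ := fun v v' => (‖v'‖ ^ 2 - ‖v‖ ^ 2) / 2) (by fun_prop)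
      hAm V 0 w, fun z hz => ?_⟩
    simp only [hωA z hz, indicator_of_mem hz]
    exact (collisionSum_clamped_eq_sum Φ hz (fun i => ω i z) _ w).symm
  · exact (abs_collisionSum_clamped_le hσ Φ hz hL (hLm k) (δ := fun v v' => v' k - v k) (hδm k)
      (η := fun i => ω i z) (fun i => hω01 i z) (fun i => hωB z i)).trans hfin
  · exact (abs_collisionSum_clamped_le hσ Φ hz hL hLe (δ := fun v v' => (‖v'‖ ^ 2 - ‖v‖ ^ 2) / 2) hδe
      (η := fun i => ω i z) (fun i => hω01 i z) (fun i => hωB z i)).trans hfin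

end Summit.AtomisticToContinuum.HydrodynamicLimit.Theorems.ClampedCurrentsDockClampedMeasurable

end
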